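import Literature.Analysis.FluidPDE.SereginZhou2020CubicEstimate
import Literature.Analysis.FluidPDE.Seregin2020ScaledEnergyBoundsA
import Literature.Analysis.FluidPDE.SereginZhou2020Proofs
import HarnessLib

/-!
# Seregin–Zhou 2020, Theorem 1.2 (qualitative form): bounded scaled energies for suitable weak
# solutions in `L_∞(0,T; Ḃ^{-1}_{∞,∞})` — proof

Analysis/FluidPDE proof file (theorems only; no definitions, no named facts). It proves the
faithful rendering of G. Seregin, D. Zhou, *Regularity of solutions to the Navier–Stokes
equations in `Ḃ^{-1}_{∞,∞}`*, J. Math. Sci. 244 (2020) = arXiv:1802.03600, **Theorem 1.2**: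
under `SereginZhou2020.Hypotheses T v q G` (`SereginZhou2020.lean`), for every `z₀ = (t₀, x₀)`
with `t₀ ∈ ]0,T]` and `R₀ = ½ min{1, t₀}`,

  `sup_{0<r<R₀} A_ess(z₀,r) < ∞`, `sup_{0<r<R₀} E(z₀,r) < ∞`, `sup_{0<r<R₀} C(z₀,r) < ∞`

(`scaledEnergiesEss_lt_top`; `A_ess = cknAEss`, `E = cknE`, `C = cknC`). This is the named
fact `SereginZhou2020.scaledEnergies_lt_top` with the tree's genuine-supremum energy `cknA`
replaced by the essential supremum `cknAEss` — the statement as printed (the paper's `A` is an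
`ess sup`, Def. 1.1 (i)); the `cknA` rendering is refuted in
`SereginZhou2020Counterexample.lean`.

## Proof (Seregin–Zhou 2020, §2, proof of Thm 1.2, pp. 4–5)

With `ℰ(r) = A_ess(r) + E(r) + D(r)` at `z₀` and a ratio `0 < θ ≤ 1/4`, for `0 < ρ ≤ R₀`
(all cylinders involved lie in the slab `(0,T) × ℝ³` since `4R₀² ≤ t₀`):
* the local energy inequality at the top of the slab
  (`Seregin2020.localEnergyBound_top`):
  `A_ess(θρ) + E(θρ) ≤ c₁ C(2θρ)^{2/3} + c₂ C(2θρ) + c₃ D(2θρ)^{2/3} C(2θρ)^{1/3}`;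
* the decay estimate for the pressure (`seregin_sverak_pressure_decay_holds.ratio`, at `ρ/2`
  with ratio `2θ`): `D(θρ) ≤ c (2θ D(ρ/2) + (2θ)⁻² C(ρ/2))`, `D(ρ/2) ≤ 4 D(ρ)`;
* Lemma 2.4 (C) (`exists_cknC_le_rpow_three_quarters`):
  `C(ρ/2) ≤ κ ℰ(ρ)^{3/4}`, `κ = c max{‖v‖_{L_∞Ḃ^{-1}_{∞,∞}}, 1}^{3/2}`, and
  `C(2θρ) ≤ (4θ)⁻² C(ρ/2)`, `D(2θρ) ≤ (2θ)⁻² D(ρ)` (monotonicity).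
Young's inequality (`D^{2/3}C^{1/3} ≤ s D + s⁻² C`, `k ℰ^p ≤ ε ℰ + K(k,ε,p)` for `p = 1/2, 3/4`)
and the choice `64(c+1)θ ≤ 1`, `c₃ s (2θ)⁻² ≤ 1/8` give `ℰ(θρ) ≤ ½ ℰ(ρ) + K`; iterating along
`θᵏ R₀` from `ℰ(R₀) < ∞` (the energy class of Def. 1.1 (i) with `δ = t₀ − R₀² ≥ 3t₀/4`) and
monotonicity bound `A_ess, E, D` on `]0, R₀]`; then `C(r) ≤ κ (A_ess(2r) + E(2r))^{3/4}` for
`2r ≤ R₀` and `C(r) ≤ 4 C(R₀) < ∞` (`Hypotheses.cknC_lt_top`) for `R₀ < 2r < 2R₀`.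

(The paper deduces Lemma 2.4 from the weak-`L⁴` interpolation of Lemma 2.1 and the cut-off
Lemma 2.2 in `Ḃ^{-1}_{∞,∞}`; the tree's substitute is the heat-flow form
`SereginZhou2020BesovPairing.lean` → `SereginZhou2020WeakL4.lean` →
`SereginZhou2020CubicEstimate.lean`.)

## Contents (namespace `Literature.Analysis.FluidPDE.SereginZhou2020`)

* `Hypotheses.cknAEss_ne_top`, `Hypotheses.cknE_ne_top`, `Hypotheses.cknD_ne_top` — finiteness
  of `A_ess, E, D` on cylinders with `0 < t − r²`, `t ≤ T` (energy class);
* `exists_absorb` — the Young absorption step;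
* `scaledEnergiesEss_lt_top` — **Theorem 1.2** (faithful rendering);
* `Hypotheses.limsup_cknC_lt_top` — Type I only: `limsup_{r→0⁺} C(z₀,r) < ∞`;
* `Hypotheses.exists_scaledEnergies_le` — `A_ess + E + C + D ≤ K` on some `]0, r₁]` at every
  `z₀` (with `Seregin2020.scaledEnergies_bounded_of_limsup_cknC_lt_top`).

## References

* G. Seregin, D. Zhou, J. Math. Sci. 244 (2020) 1003–1009 = arXiv:1802.03600, Thm 1.2 and its
  proof (§2), Lemma 2.4, Def. 1.1. [`SereginZhou2020`]
* G. Seregin, V. Šverák, arXiv:0804.1803, proof of Lemma 3.5 (pressure decay).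
  [`SereginSverak2009`]
* G. Seregin, Anal. Math. Phys. 10 (2020), Paper 46 = arXiv:2006.04140, remark after Def. 1.7
  (`g < ∞ ⟹ G < ∞`). [`Seregin2020`]
-/

noncomputable section

open MeasureTheory Set Function Filter Topology Metric TopologicalSpace
open scoped ENNReal NNReal

namespace Literature.Analysis.FluidPDE

open Literature.Analysis.UnboundedOperators

namespace SereginZhou2020

/-! ### Absorption of sublinear terms -/

/-- **Absorption step of the iteration**: for finite `k₁, k₂` there is a finite `K` with
`X ≤ L P + k₁ P^{1/2} + k₂ P^{3/4}`, `L ≤ 1/4` `⟹` `X ≤ P/2 + K` (Young's inequality with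
`ε = 1/8` for each sublinear term). [folklore] -/
theorem exists_absorb (k₁ k₂ : ℝ≥0∞) (hk₁ : k₁ ≠ ⊤) (hk₂ : k₂ ≠ ⊤) :
    ∃ K : ℝ≥0∞, K ≠ ⊤ ∧ ∀ P X L : ℝ≥0∞, L ≤ ENNReal.ofReal (1 / 4) →
      X ≤ L * P + k₁ * P ^ (1 / 2 : ℝ) + k₂ * P ^ (3 / 4 : ℝ) → X ≤ P / 2 + K := by
  set ε : ℝ≥0∞ := ENNReal.ofReal (1 / 8) with hε
  have hε0 : ε ≠ 0 := by rw [hε]; exact (ENNReal.ofReal_pos.2 (by norm_num)).ne'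
  have hεtop : ε ≠ ⊤ := ENNReal.ofReal_ne_top
  have hεinv : ε⁻¹ ≠ ⊤ := ENNReal.inv_ne_top.2 hε0
  set K₁ : ℝ≥0∞ := (k₁ * ε⁻¹ ^ (1 / 2 : ℝ)) ^ (1 / (1 - 1 / 2 : ℝ)) with hK₁
  set K₂ : ℝ≥0∞ := (k₂ * ε⁻¹ ^ (3 / 4 : ℝ)) ^ (1 / (1 - 3 / 4 : ℝ)) with hK₂
  have hK₁top : K₁ ≠ ⊤ := ENNReal.rpow_ne_top_of_nonneg (by norm_num)
    (ENNReal.mul_ne_top hk₁ (ENNReal.rpow_ne_top_of_nonneg (by norm_num) hεinv))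
  have hK₂top : K₂ ≠ ⊤ := ENNReal.rpow_ne_top_of_nonneg (by norm_num)
    (ENNReal.mul_ne_top hk₂ (ENNReal.rpow_ne_top_of_nonneg (by norm_num) hεinv))
  refine ⟨K₁ + K₂, ENNReal.add_ne_top.2 ⟨hK₁top, hK₂top⟩, fun P X L hL h => ?_⟩
  have y₁ : k₁ * P ^ (1 / 2 : ℝ) ≤ ε * P + K₁ :=
    Seregin2020.rpow_le_mul_add (by norm_num) (by norm_num) k₁ P hε0 hεtop
  have y₂ : k₂ * P ^ (3 / 4 : ℝ) ≤ ε * P + K₂ :=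
    Seregin2020.rpow_le_mul_add (by norm_num) (by norm_num) k₂ P hε0 hεtop
  have hsum : ENNReal.ofReal (1 / 4) * P + ε * P + ε * P = P / 2 := by
    rw [hε, ← add_mul, ← add_mul, ← ENNReal.ofReal_add (by norm_num) (by norm_num),
      ← ENNReal.ofReal_add (by norm_num) (by norm_num), div_eq_mul_inv P 2, mul_comm P]
    congr 1
    rw [← ENNReal.ofReal_ofNat 2, ← ENNReal.ofReal_inv_of_pos (by norm_num : (0 : ℝ) < 2)]
    congr 1
    norm_num
  calc X ≤ L * P + k₁ * P ^ (1 / 2 : ℝ) + k₂ * P ^ (3 / 4 : ℝ) := h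
    _ ≤ ENNReal.ofReal (1 / 4) * P + (ε * P + K₁) + (ε * P + K₂) :=
        add_le_add (add_le_add (mul_le_mul_left hL _) y₁) y₂
    _ = ENNReal.ofReal (1 / 4) * P + ε * P + ε * P + (K₁ + K₂) := by ring
    _ = P / 2 + (K₁ + K₂) := by rw [hsum]

/-! ### Finiteness of the scaled quantities away from `t = 0` (energy class, Def. 1.1 (i)) -/

section Finite

variable {T : ℝ} {v : ℝ → EuclideanSpace ℝ (Fin 3) → EuclideanSpace ℝ (Fin 3)}
  {q : ℝ → EuclideanSpace ℝ (Fin 3) → ℝ}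
  {G : ℝ → EuclideanSpace ℝ (Fin 3) → EuclideanSpace ℝ (Fin 3) →L[ℝ] EuclideanSpace ℝ (Fin 3)}
  {z : ℝ × EuclideanSpace ℝ (Fin 3)} {r : ℝ}

/-- `A_ess(r; z) < ∞` for cylinders with `0 < t_z − r²`, `t_z ≤ T`, from the energy class of
Def. 1.1 (i) (`v ∈ L_∞(δ,T; L_{2,loc})`, `δ = t_z − r²`). [cite: SereginZhou2020, Def. 1.1 (i)] -/
theorem Hypotheses.cknAEss_ne_top (hyp : Hypotheses T v q G) (hr : 0 < r)
    (hz0 : 0 < z.1 - r ^ 2) (hzT : z.1 ≤ T) : cknAEss r z v ≠ ⊤ := by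
  obtain ⟨⟨Cb, hCb⟩, -, -⟩ :=
    hyp.energyClass (z.1 - r ^ 2) hz0 (by linarith [pow_pos hr 2]) z.2 r hr
  have hA : cknAEss r z v ≤ (ENNReal.ofReal r)⁻¹ * Cb := by
    rw [cknAEss]
    refine essSup_le_of_ae_le _ ?_
    rw [Filter.EventuallyLE, ae_restrict_iff' measurableSet_Ioo]
    filter_upwards [hCb] with t ht htI
    exact mul_le_mul_right (ht ⟨htI.1, lt_of_lt_of_le htI.2 hzT⟩) _
  exact ne_top_of_le_ne_top (ENNReal.mul_ne_top
    (ENNReal.inv_ne_top.2 (ENNReal.ofReal_pos.2 hr).ne') ENNReal.coe_ne_top) hA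

/-- `E(r; z) < ∞` for cylinders with `0 < t_z − r²`, `t_z ≤ T`, from the energy class of
Def. 1.1 (i) (`∇v ∈ L₂((δ,T) × B)`). [cite: SereginZhou2020, Def. 1.1 (i)] -/
theorem Hypotheses.cknE_ne_top (hyp : Hypotheses T v q G) (hr : 0 < r)
    (hz0 : 0 < z.1 - r ^ 2) (hzT : z.1 ≤ T) : cknE r z G ≠ ⊤ := by
  obtain ⟨-, hGfin, -⟩ :=
    hyp.energyClass (z.1 - r ^ 2) hz0 (by linarith [pow_pos hr 2]) z.2 r hr
  have hcyl : parabolicCylinder r z ⊆ Ioo (z.1 - r ^ 2) T ×ˢ ball z.2 r := by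
    intro p hp
    rw [mem_parabolicCylinder] at hp
    exact ⟨⟨hp.1.1, lt_of_lt_of_le hp.1.2 hzT⟩, mem_ball.2 hp.2⟩
  have hE : cknE r z G ≤ (ENNReal.ofReal r)⁻¹ *
      ∫⁻ p in Ioo (z.1 - r ^ 2) T ×ˢ ball z.2 r, ENNReal.ofReal (frobeniusNormSq (G p.1 p.2)) := by
    rw [cknE]
    exact mul_le_mul_right (lintegral_mono_set hcyl) _
  exact ne_top_of_le_ne_top (ENNReal.mul_ne_top
    (ENNReal.inv_ne_top.2 (ENNReal.ofReal_pos.2 hr).ne') hGfin.ne) hE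

/-- `D(r; z) < ∞` for cylinders with `0 < t_z − r²`, `t_z ≤ T`, from the energy class of
Def. 1.1 (i) (`q ∈ L_{3/2}((δ,T) × B)`). [cite: SereginZhou2020, Def. 1.1 (i)] -/
theorem Hypotheses.cknD_ne_top (hyp : Hypotheses T v q G) (hr : 0 < r)
    (hz0 : 0 < z.1 - r ^ 2) (hzT : z.1 ≤ T) : cknD r z q ≠ ⊤ := by
  obtain ⟨-, -, hqfin⟩ :=
    hyp.energyClass (z.1 - r ^ 2) hz0 (by linarith [pow_pos hr 2]) z.2 r hr
  have hcyl : parabolicCylinder r z ⊆ Ioo (z.1 - r ^ 2) T ×ˢ ball z.2 r := by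
    intro p hp
    rw [mem_parabolicCylinder] at hp
    exact ⟨⟨hp.1.1, lt_of_lt_of_le hp.1.2 hzT⟩, mem_ball.2 hp.2⟩
  have hD : cknD r z q ≤ (ENNReal.ofReal r ^ 2)⁻¹ *
      ∫⁻ p in Ioo (z.1 - r ^ 2) T ×ˢ ball z.2 r, ‖q p.1 p.2‖ₑ ^ (3 / 2 : ℝ) := by
    rw [cknD]
    exact mul_le_mul_right (lintegral_mono_set hcyl) _
  exact ne_top_of_le_ne_top (ENNReal.mul_ne_top
    (ENNReal.inv_ne_top.2 (pow_ne_zero _ (ENNReal.ofReal_pos.2 hr).ne')) hqfin.ne) hD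

end Finite

/-! ### Theorem 1.2 -/

/-- **Seregin–Zhou 2020, Theorem 1.2 (qualitative form: bounded scaled energies), faithful
rendering.** Under `Hypotheses T v q G` — `(v, q)` a suitable weak solution of Navier–Stokes on
`ℝ³ × ]0,T[` in the energy class of Def. 1.1 (i) up to `T`, `G = ∇v` weakly, and
`v ∈ L_∞(0,T; Ḃ^{-1}_{∞,∞})` — for every `z₀ = (t₀, x₀)` with `t₀ ∈ ]0,T]` and
`r₀ = ½ min{1, t₀}`: `sup_{0<r<r₀} A(z₀,r) < ∞`, `sup_{0<r<r₀} E(z₀,r) < ∞`,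
`sup_{0<r<r₀} C(z₀,r) < ∞`, with `A` the essential supremum in time (`cknAEss`; the paper's
`A`, `v ∈ L_∞(δ,T;L_{2,loc})`), `E = cknE`, `C = cknC`. This is
`SereginZhou2020.scaledEnergies_lt_top` with `cknA` replaced by `cknAEss` (the `cknA` rendering
is refuted, `SereginZhou2020.not_scaledEnergies_lt_top`). Printed with the quantitative bound
`≤ c[r₀^{1/2} + ‖v‖² + ‖v‖⁶]`, `c = c(C(z₀,1), D(z₀,1))`; only the finiteness is rendered.
[cite: SereginZhou2020, Thm 1.2] -/
theorem scaledEnergiesEss_lt_top :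
    ∀ (T : ℝ) (v : ℝ → EuclideanSpace ℝ (Fin 3) → EuclideanSpace ℝ (Fin 3))
      (q : ℝ → EuclideanSpace ℝ (Fin 3) → ℝ)
      (G : ℝ → EuclideanSpace ℝ (Fin 3) → EuclideanSpace ℝ (Fin 3) →L[ℝ] EuclideanSpace ℝ (Fin 3)),
      Hypotheses T v q G → ∀ t₀ ∈ Ioc 0 T, ∀ x₀ : EuclideanSpace ℝ (Fin 3),
        (⨆ r ∈ Ioo 0 (min 1 t₀ / 2), cknAEss r (t₀, x₀) v) < ∞ ∧
        (⨆ r ∈ Ioo 0 (min 1 t₀ / 2), cknE r (t₀, x₀) G) < ∞ ∧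
        (⨆ r ∈ Ioo 0 (min 1 t₀ / 2), cknC r (t₀, x₀) v) < ∞ := by
  intro T v q G hyp t₀ ht₀ x₀
  obtain ⟨M, hM⟩ := hyp.besov
  obtain ⟨c₁, c₂, c₃, HT⟩ := Seregin2020.localEnergyBound_top
  obtain ⟨cp, hcp⟩ := seregin_sverak_pressure_decay_holds.ratio
  obtain ⟨c₄, hc₄⟩ := exists_cknC_le_rpow_three_quarters
  have ht₀0 : 0 < t₀ := ht₀.1
  have ht₀T : t₀ ≤ T := ht₀.2
  -- ### the slab, the solution, the centre, the radius `R₀ = min{1,t₀}/2`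
  set Q : Opens (ℝ × EuclideanSpace ℝ (Fin 3)) :=
    slab (EuclideanSpace ℝ (Fin 3)) (Ioo 0 T) isOpen_Ioo with hQdef
  have hsw : IsSuitableWeakSolutionOn Q 1 0 v q := hyp.suitable
  have hG : HasWeakSpatialGradientOn Q v G := hyp.weakGradient
  set z : ℝ × EuclideanSpace ℝ (Fin 3) := (t₀, x₀) with hz
  have hz1 : z.1 = t₀ := rfl
  have hz2 : z.2 = x₀ := rfl
  have hQsub : ∀ ρ : ℝ, ρ ^ 2 ≤ t₀ →
      parabolicCylinder ρ z ⊆ (Q : Set (ℝ × EuclideanSpace ℝ (Fin 3))) := by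
    intro ρ hρt p hp
    rw [mem_parabolicCylinder, hz1] at hp
    exact mem_slab.2 ⟨by linarith [hp.1.1], lt_of_lt_of_le hp.1.2 ht₀T⟩
  set R₀ : ℝ := min 1 t₀ / 2 with hR₀
  have hR₀0 : 0 < R₀ := by rw [hR₀]; exact half_pos (lt_min one_pos ht₀0)
  have hR₀1 : R₀ ≤ 1 / 2 := by rw [hR₀]; linarith [min_le_left (1 : ℝ) t₀]
  have hR₀t : R₀ ≤ t₀ / 2 := by rw [hR₀]; linarith [min_le_right (1 : ℝ) t₀]
  have hR₀sq : R₀ ^ 2 ≤ t₀ / 4 := by nlinarith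
  -- ### Lemma 2.4 (C) at the scales `ρ/2 ⊂ ρ`
  set κ : ℝ≥0∞ := (c₄ : ℝ≥0∞) * ENNReal.ofReal (max M 1) ^ (3 / 2 : ℝ) with hκ
  have hκtop : κ ≠ ⊤ := ENNReal.mul_ne_top ENNReal.coe_ne_top
    (ENNReal.rpow_ne_top_of_nonneg (by norm_num) ENNReal.ofReal_ne_top)
  have hC4 : ∀ ρ : ℝ, 0 < ρ → ρ ^ 2 ≤ t₀ →
      cknC (ρ / 2) z v ≤ κ * (cknAEss ρ z v + cknE ρ z G) ^ (3 / 4 : ℝ) := by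
    intro ρ hρ hρt
    have h := hc₄ T v q G M hyp hM z (ρ / 2) (half_pos hρ) (by rw [hz1]; nlinarith)
      (by rw [hz1]; exact ht₀T)
    rwa [show 2 * (ρ / 2) = ρ by ring] at h
  -- ### the ratio `θ` and the Young parameter `s`
  have hcp0 : (0 : ℝ) ≤ cp := cp.coe_nonneg
  have hc₃0 : (0 : ℝ) ≤ c₃ := c₃.coe_nonneg
  set θ : ℝ := min (1 / 4) (1 / (64 * ((cp : ℝ) + 1))) with hθ
  have hθ0 : 0 < θ := by rw [hθ]; exact lt_min (by norm_num) (by positivity)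
  have hθ4 : θ ≤ 1 / 4 := min_le_left _ _
  have hθ1 : θ ≤ 1 := hθ4.trans (by norm_num)
  have hθlt1 : θ < 1 := lt_of_le_of_lt hθ4 (by norm_num)
  have hθc : 64 * ((cp : ℝ) + 1) * θ ≤ 1 := by
    have h : θ ≤ 1 / (64 * ((cp : ℝ) + 1)) := min_le_right _ _
    calc 64 * ((cp : ℝ) + 1) * θ ≤ 64 * ((cp : ℝ) + 1) * (1 / (64 * ((cp : ℝ) + 1))) :=
          mul_le_mul_of_nonneg_left h (by positivity)
      _ = 1 := mul_one_div_cancel (by positivity)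
  set σ : ℝ := (2 * θ) ^ 2 / (8 * ((c₃ : ℝ) + 1)) with hσ
  have hσ0 : 0 < σ := by rw [hσ]; positivity
  set s : ℝ≥0∞ := ENNReal.ofReal σ with hs
  have hs0 : s ≠ 0 := by rw [hs]; exact (ENNReal.ofReal_pos.2 hσ0).ne'
  have hstop : s ≠ ⊤ := ENNReal.ofReal_ne_top
  set β : ℝ≥0∞ := ENNReal.ofReal ((4 * θ)⁻¹) ^ 2 with hβ
  set γ : ℝ≥0∞ := ENNReal.ofReal ((2 * θ)⁻¹) ^ 2 with hγ
  have hβtop : β ≠ ⊤ := ENNReal.pow_ne_top ENNReal.ofReal_ne_top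
  have hγtop : γ ≠ ⊤ := ENNReal.pow_ne_top ENNReal.ofReal_ne_top
  -- the two linear coefficients are at most `1/8` each
  have hlin1 : (cp : ℝ≥0∞) * ENNReal.ofReal (2 * θ) * ENNReal.ofReal 2 ^ 2 ≤
      ENNReal.ofReal (1 / 8) := by
    rw [← ENNReal.ofReal_coe_nnreal, ← ENNReal.ofReal_pow (by norm_num : (0 : ℝ) ≤ 2),
      ← ENNReal.ofReal_mul hcp0, ← ENNReal.ofReal_mul (by positivity)]
    refine ENNReal.ofReal_le_ofReal ?_
    nlinarith [hθc, hθ0.le, hcp0]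
  have hlin2 : (c₃ : ℝ≥0∞) * s * γ ≤ ENNReal.ofReal (1 / 8) := by
    have h2θ : (0 : ℝ) < 2 * θ := by positivity
    rw [hs, hγ, ← ENNReal.ofReal_coe_nnreal, ← ENNReal.ofReal_pow (inv_nonneg.2 h2θ.le),
      ← ENNReal.ofReal_mul hc₃0, ← ENNReal.ofReal_mul (mul_nonneg hc₃0 hσ0.le)]
    refine ENNReal.ofReal_le_ofReal ?_
    have e : (c₃ : ℝ) * σ * ((2 * θ)⁻¹) ^ 2 = (c₃ : ℝ) / (8 * ((c₃ : ℝ) + 1)) := by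
      calc (c₃ : ℝ) * σ * ((2 * θ)⁻¹) ^ 2
          = (c₃ : ℝ) / (8 * ((c₃ : ℝ) + 1)) * ((2 * θ) ^ 2 * ((2 * θ) ^ 2)⁻¹) := by
            rw [hσ, inv_pow]; ring
        _ = (c₃ : ℝ) / (8 * ((c₃ : ℝ) + 1)) := by
            rw [mul_inv_cancel₀ (by positivity), mul_one]
    rw [e, div_le_iff₀ (by positivity)]
    nlinarith [hc₃0]
  -- ### the sublinear coefficients and the absorption constant
  set k₁ : ℝ≥0∞ := (c₁ : ℝ≥0∞) * (β * κ) ^ (2 / 3 : ℝ) with hk₁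
  set k₂ : ℝ≥0∞ := (c₂ : ℝ≥0∞) * (β * κ) + (c₃ : ℝ≥0∞) * s⁻¹ ^ 2 * (β * κ) +
    (cp : ℝ≥0∞) * γ * κ with hk₂
  have hβκ : β * κ ≠ ⊤ := ENNReal.mul_ne_top hβtop hκtop
  have hk₁top : k₁ ≠ ⊤ :=
    ENNReal.mul_ne_top ENNReal.coe_ne_top (ENNReal.rpow_ne_top_of_nonneg (by norm_num) hβκ)
  have hk₂top : k₂ ≠ ⊤ := by
    refine ENNReal.add_ne_top.2 ⟨ENNReal.add_ne_top.2 ⟨ENNReal.mul_ne_top ENNReal.coe_ne_top hβκ,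
      ENNReal.mul_ne_top (ENNReal.mul_ne_top ENNReal.coe_ne_top
        (ENNReal.pow_ne_top (ENNReal.inv_ne_top.2 hs0))) hβκ⟩,
      ENNReal.mul_ne_top (ENNReal.mul_ne_top ENNReal.coe_ne_top hγtop) hκtop⟩
  obtain ⟨K, hKtop, habs⟩ := exists_absorb k₁ k₂ hk₁top hk₂top
  -- ### the combined quantity `ℰ = A_ess + E + D` and the one-step estimate
  set Φ : ℝ → ℝ≥0∞ := fun ρ => cknAEss ρ z v + cknE ρ z G + cknD ρ z q with hΦ
  have hstep : ∀ ρ : ℝ, 0 < ρ → ρ ≤ R₀ → Φ (θ * ρ) ≤ Φ ρ / 2 + K := by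
    intro ρ hρ hρR
    have hρsq : ρ ^ 2 ≤ R₀ ^ 2 := pow_le_pow_left₀ hρ.le hρR 2
    have hρt : ρ ^ 2 ≤ t₀ := by linarith
    have hθρ : 0 < θ * ρ := mul_pos hθ0 hρ
    have h2θρ : 0 < 2 * (θ * ρ) := by positivity
    have hρ2 : 0 < ρ / 2 := half_pos hρ
    have h2θρle : 2 * (θ * ρ) ≤ ρ / 2 := by nlinarith
    have h2θρt : (2 * (θ * ρ)) ^ 2 ≤ t₀ :=
      (pow_le_pow_left₀ h2θρ.le (h2θρle.trans (by linarith)) 2).trans hρt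
    have hρ2t : (ρ / 2) ^ 2 ≤ t₀ := (pow_le_pow_left₀ hρ2.le (by linarith) 2).trans hρt
    -- names
    set P : ℝ≥0∞ := Φ ρ with hP
    have hPdef : P = cknAEss ρ z v + cknE ρ z G + cknD ρ z q := rfl
    set C₂ : ℝ≥0∞ := cknC (ρ / 2) z v with hC₂
    set Cθ : ℝ≥0∞ := cknC (2 * (θ * ρ)) z v with hCθ
    set Dθ : ℝ≥0∞ := cknD (2 * (θ * ρ)) z q with hDθ
    set W : ℝ≥0∞ := β * κ * P ^ (3 / 4 : ℝ) with hW
    -- inclusions of cylinders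
    have hsubθ2 : parabolicCylinder (2 * (θ * ρ)) z ⊆ parabolicCylinder (ρ / 2) z :=
      parabolicCylinder_mono h2θρ.le h2θρle z
    have hsubθ : parabolicCylinder (2 * (θ * ρ)) z ⊆ parabolicCylinder ρ z :=
      parabolicCylinder_mono h2θρ.le (h2θρle.trans (by linarith)) z
    have hsub2 : parabolicCylinder (ρ / 2) z ⊆ parabolicCylinder ρ z :=
      parabolicCylinder_mono hρ2.le (by linarith) z
    -- (i) `C(ρ/2) ≤ κ ℰ(ρ)^{3/4}`
    have hC₂P : C₂ ≤ κ * P ^ (3 / 4 : ℝ) := by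
      refine (hC4 ρ hρ hρt).trans (mul_le_mul_right (ENNReal.rpow_le_rpow ?_ (by norm_num)) _)
      rw [hPdef]; exact le_self_add
    -- (ii) `C(2θρ) ≤ (4θ)⁻² C(ρ/2) ≤ W`
    have hCθW : Cθ ≤ W := by
      have h := Seregin2020.cknC_le_mul_of_subset hρ2 h2θρ hsubθ2 v
      have e : ρ / 2 / (2 * (θ * ρ)) = (4 * θ)⁻¹ := by
        field_simp
        ring
      rw [e] at h
      refine h.trans ?_
      rw [hW, mul_assoc]
      exact mul_le_mul_right hC₂P _
    -- (iii) `D(2θρ) ≤ (2θ)⁻² ℰ(ρ)`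
    have hDθP : Dθ ≤ γ * P := by
      have h := cknD_le_mul_of_subset hρ h2θρ hsubθ q
      have e : ρ / (2 * (θ * ρ)) = (2 * θ)⁻¹ := by
        field_simp
      rw [e] at h
      refine h.trans (mul_le_mul_right ?_ _)
      rw [hPdef]; exact le_add_self
    -- (iv) `D(ρ/2) ≤ 4 ℰ(ρ)`
    have hD₂P : cknD (ρ / 2) z q ≤ ENNReal.ofReal 2 ^ 2 * P := by
      have h := cknD_le_mul_of_subset hρ hρ2 hsub2 q
      have e : ρ / (ρ / 2) = 2 := by field_simp
      rw [e] at h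
      refine h.trans (mul_le_mul_right ?_ _)
      rw [hPdef]; exact le_add_self
    -- the local energy bound at `R = 2θρ`
    have hLE : cknAEss (θ * ρ) z v + cknE (θ * ρ) z G ≤
        c₁ * Cθ ^ (2 / 3 : ℝ) + c₂ * Cθ + c₃ * (Dθ ^ (2 / 3 : ℝ) * Cθ ^ (1 / 3 : ℝ)) := by
      have h := HT Q v q G hsw hG z (2 * (θ * ρ)) h2θρ (hQsub _ h2θρt)
      rwa [show 2 * (θ * ρ) / 2 = θ * ρ by ring] at h
    -- the pressure decay estimate at `ρ/2` with ratio `2θ`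
    have hPD : cknD (θ * ρ) z q ≤ cp * (ENNReal.ofReal (2 * θ) * cknD (ρ / 2) z q + γ * C₂) := by
      have h := hcp Q v q hsw.distributional z (ρ / 2) (2 * θ) hρ2 (by positivity) (by linarith)
        (hQsub _ hρ2t)
      rw [show 2 * θ * (ρ / 2) = θ * ρ by ring,
        ENNReal.ofReal_pow (inv_nonneg.2 (by positivity : (0 : ℝ) ≤ 2 * θ))] at h
      exact h
    -- Young for the mixed term
    have hY : Dθ ^ (2 / 3 : ℝ) * Cθ ^ (1 / 3 : ℝ) ≤ s * Dθ + s⁻¹ ^ 2 * Cθ :=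
      Seregin2020.rpow_two_thirds_mul_rpow_one_third_le Dθ Cθ hs0 hstop
    -- collect `A_ess(θρ) + E(θρ)`
    have hAE : cknAEss (θ * ρ) z v + cknE (θ * ρ) z G ≤
        c₁ * W ^ (2 / 3 : ℝ) + c₂ * W + c₃ * (s * (γ * P) + s⁻¹ ^ 2 * W) := by
      refine hLE.trans (add_le_add (add_le_add ?_ ?_) ?_)
      · exact mul_le_mul_right (ENNReal.rpow_le_rpow hCθW (by norm_num)) _
      · exact mul_le_mul_right hCθW _
      · exact mul_le_mul_right (hY.trans (add_le_add (mul_le_mul_right hDθP _)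
          (mul_le_mul_right hCθW _))) _
    -- collect `D(θρ)`
    have hD : cknD (θ * ρ) z q ≤ cp * (ENNReal.ofReal (2 * θ) * (ENNReal.ofReal 2 ^ 2 * P) +
        γ * (κ * P ^ (3 / 4 : ℝ))) :=
      hPD.trans (mul_le_mul_right (add_le_add (mul_le_mul_right hD₂P _)
        (mul_le_mul_right hC₂P _)) _)
    -- the algebra
    have hW23 : W ^ (2 / 3 : ℝ) = (β * κ) ^ (2 / 3 : ℝ) * P ^ (1 / 2 : ℝ) := by
      rw [hW, ENNReal.mul_rpow_of_nonneg _ _ (by norm_num), ← ENNReal.rpow_mul]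
      norm_num
    have hsum : Φ (θ * ρ) ≤
        ((c₃ : ℝ≥0∞) * s * γ + (cp : ℝ≥0∞) * ENNReal.ofReal (2 * θ) * ENNReal.ofReal 2 ^ 2) * P +
          k₁ * P ^ (1 / 2 : ℝ) + k₂ * P ^ (3 / 4 : ℝ) := by
      have e : Φ (θ * ρ) = (cknAEss (θ * ρ) z v + cknE (θ * ρ) z G) + cknD (θ * ρ) z q := rfl
      rw [e]
      refine (add_le_add hAE hD).trans (le_of_eq ?_)
      rw [hW23, hW, hk₁, hk₂]
      ring
    have hL : (c₃ : ℝ≥0∞) * s * γ + (cp : ℝ≥0∞) * ENNReal.ofReal (2 * θ) * ENNReal.ofReal 2 ^ 2 ≤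
        ENNReal.ofReal (1 / 4) := by
      refine (add_le_add hlin2 hlin1).trans (le_of_eq ?_)
      rw [← ENNReal.ofReal_add (by norm_num) (by norm_num)]
      norm_num
    exact habs P (Φ (θ * ρ)) _ hL hsum
  -- ### finiteness at the top scale `R₀` (energy class of Def. 1.1 (i))
  have hΦR₀ : Φ R₀ ≠ ⊤ := by
    have h0 : 0 < z.1 - R₀ ^ 2 := by rw [hz1]; linarith
    have hT' : z.1 ≤ T := by rw [hz1]; exact ht₀T
    exact ENNReal.add_ne_top.2 ⟨ENNReal.add_ne_top.2 ⟨hyp.cknAEss_ne_top hR₀0 h0 hT',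
      hyp.cknE_ne_top hR₀0 h0 hT'⟩, hyp.cknD_ne_top hR₀0 h0 hT'⟩
  -- ### iteration along `θᵏ R₀`
  set Lb : ℝ≥0∞ := 2 * K + Φ R₀ with hLb
  have hLbtop : Lb ≠ ⊤ :=
    ENNReal.add_ne_top.2 ⟨ENNReal.mul_ne_top ENNReal.ofNat_ne_top hKtop, hΦR₀⟩
  have hΦk : ∀ k : ℕ, Φ (θ ^ k * R₀) ≤ Lb := by
    intro k
    refine (iterate_half_le (φ := Φ) hθ0 hθ1 hR₀0 hstep k).trans ?_
    rw [hLb]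
    refine add_le_add le_rfl ?_
    calc (2⁻¹ : ℝ≥0∞) ^ k * Φ R₀ ≤ 1 * Φ R₀ :=
          mul_le_mul_left (pow_le_one₀ zero_le (ENNReal.inv_le_one.2 one_le_two)) _
      _ = Φ R₀ := one_mul _
  -- ### every scale `0 < r ≤ R₀`
  have hscale : ∀ r : ℝ, 0 < r → r ≤ R₀ →
      cknAEss r z v ≤ ENNReal.ofReal θ⁻¹ * Lb ∧ cknE r z G ≤ ENNReal.ofReal θ⁻¹ * Lb ∧
        cknD r z q ≤ ENNReal.ofReal θ⁻¹ ^ 2 * Lb := by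
    intro r hr hrR
    obtain ⟨J, hJ1, hJ2⟩ := exists_nat_pow_near_of_lt_one (div_pos hr hR₀0)
      ((div_le_one hR₀0).2 hrR) hθ0 hθlt1
    have hle : r ≤ θ ^ J * R₀ := by rwa [div_le_iff₀ hR₀0] at hJ2
    have hlt : θ ^ J * R₀ < θ⁻¹ * r := by
      rw [lt_div_iff₀ hR₀0] at hJ1
      have e : θ ^ J * R₀ = θ⁻¹ * (θ ^ (J + 1) * R₀) := by
        rw [pow_succ]; field_simp
      rw [e]
      exact mul_lt_mul_of_pos_left hJ1 (inv_pos.2 hθ0)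
    have hJ0 : 0 < θ ^ J * R₀ := by positivity
    have hratio : θ ^ J * R₀ / r ≤ θ⁻¹ := (div_le_iff₀ hr).2 hlt.le
    have hsub : parabolicCylinder r z ⊆ parabolicCylinder (θ ^ J * R₀) z :=
      parabolicCylinder_mono hr.le hle z
    have hΦJ : cknAEss (θ ^ J * R₀) z v + cknE (θ ^ J * R₀) z G + cknD (θ ^ J * R₀) z q ≤ Lb :=
      hΦk J
    have hAJ : cknAEss (θ ^ J * R₀) z v ≤ Lb := le_self_add.trans (le_self_add.trans hΦJ)
    have hEJ : cknE (θ ^ J * R₀) z G ≤ Lb := le_add_self.trans (le_self_add.trans hΦJ)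
    have hDJ : cknD (θ ^ J * R₀) z q ≤ Lb := le_add_self.trans hΦJ
    have hρρ : ENNReal.ofReal (θ ^ J * R₀ / r) ≤ ENNReal.ofReal θ⁻¹ := ENNReal.ofReal_le_ofReal hratio
    refine ⟨?_, ?_, ?_⟩
    · have hI : Ioo (z.1 - r ^ 2) z.1 ⊆ Ioo (z.1 - (θ ^ J * R₀) ^ 2) z.1 :=
        Ioo_subset_Ioo (by nlinarith [mul_nonneg (sub_nonneg.2 hle) (add_nonneg hJ0.le hr.le)])
          le_rfl
      calc cknAEss r z v ≤ ENNReal.ofReal (θ ^ J * R₀ / r) * cknAEss (θ ^ J * R₀) z v :=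
            cknAEss_le_mul_of_subset hJ0 hr hI (ball_subset_ball hle) v
        _ ≤ ENNReal.ofReal θ⁻¹ * Lb := (mul_le_mul_left hρρ _).trans (mul_le_mul_right hAJ _)
    · calc cknE r z G ≤ ENNReal.ofReal (θ ^ J * R₀ / r) * cknE (θ ^ J * R₀) z G :=
            cknE_le_mul_of_subset hJ0 hr hsub G
        _ ≤ ENNReal.ofReal θ⁻¹ * Lb := (mul_le_mul_left hρρ _).trans (mul_le_mul_right hEJ _)
    · calc cknD r z q ≤ ENNReal.ofReal (θ ^ J * R₀ / r) ^ 2 * cknD (θ ^ J * R₀) z q :=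
            cknD_le_mul_of_subset hJ0 hr hsub q
        _ ≤ ENNReal.ofReal θ⁻¹ ^ 2 * Lb :=
            (mul_le_mul_left (pow_le_pow_left₀ zero_le hρρ 2) _).trans (mul_le_mul_right hDJ _)
  -- ### conclusion
  have hθLb : ENNReal.ofReal θ⁻¹ * Lb < ⊤ := ENNReal.mul_lt_top ENNReal.ofReal_lt_top hLbtop.lt_top
  refine ⟨?_, ?_, ?_⟩
  · exact lt_of_le_of_lt (iSup₂_le fun r hr => (hscale r hr.1 hr.2.le).1) hθLb
  · exact lt_of_le_of_lt (iSup₂_le fun r hr => (hscale r hr.1 hr.2.le).2.1) hθLb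
  · have hCR₀ : cknC R₀ z v < ⊤ :=
      hyp.cknC_lt_top hR₀0 (by rw [hz1]; linarith) (by rw [hz1]; exact ht₀T)
    set CB : ℝ≥0∞ := max (κ * (ENNReal.ofReal θ⁻¹ * Lb + ENNReal.ofReal θ⁻¹ * Lb) ^ (3 / 4 : ℝ))
      (ENNReal.ofReal 2 ^ 2 * cknC R₀ z v) with hCB
    have hCBtop : CB < ⊤ := by
      rw [hCB]
      refine max_lt (ENNReal.mul_lt_top hκtop.lt_top
        (ENNReal.rpow_lt_top_of_nonneg (by norm_num) ?_))
        (ENNReal.mul_lt_top (ENNReal.pow_ne_top ENNReal.ofReal_ne_top).lt_top hCR₀)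
      exact (ENNReal.add_lt_top.2 ⟨hθLb, hθLb⟩).ne
    refine lt_of_le_of_lt (iSup₂_le fun r hr => ?_) hCBtop
    rcases le_or_gt (2 * r) R₀ with h2r | h2r
    · -- Lemma 2.4 (C) at `r`, data at `2r ≤ R₀`
      have h4r : (2 * r) ^ 2 ≤ R₀ ^ 2 := pow_le_pow_left₀ (by linarith [hr.1]) h2r 2
      have h := hc₄ T v q G M hyp hM z r hr.1 (by rw [hz1]; linarith) (by rw [hz1]; exact ht₀T)
      refine h.trans (le_trans ?_ (le_max_left _ _))
      obtain ⟨hA2, hE2, -⟩ := hscale (2 * r) (by linarith [hr.1]) h2r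
      exact mul_le_mul_right (ENNReal.rpow_le_rpow (add_le_add hA2 hE2) (by norm_num)) _
    · -- monotonicity from `R₀`, `R₀ < 2r`
      have hsub : parabolicCylinder r z ⊆ parabolicCylinder R₀ z :=
        parabolicCylinder_mono hr.1.le hr.2.le z
      refine (Seregin2020.cknC_le_mul_of_subset hR₀0 hr.1 hsub v).trans
        (le_trans ?_ (le_max_right _ _))
      refine mul_le_mul_left (pow_le_pow_left₀ zero_le (ENNReal.ofReal_le_ofReal ?_) 2) _
      rw [div_le_iff₀ hr.1]
      linarith

/-! ### Corollaries: Type I only; all four scaled quantities bounded near every point -/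

section Corollaries

variable {T : ℝ} {v : ℝ → EuclideanSpace ℝ (Fin 3) → EuclideanSpace ℝ (Fin 3)}
  {q : ℝ → EuclideanSpace ℝ (Fin 3) → ℝ}
  {G : ℝ → EuclideanSpace ℝ (Fin 3) → EuclideanSpace ℝ (Fin 3) →L[ℝ] EuclideanSpace ℝ (Fin 3)}

/-- **Type I only** (Seregin–Zhou 2020, remark after Def. 1.3: solutions of Thm 1.2 "have
Type I singularities only"): under `Hypotheses T v q G`, at every `z₀ = (t₀, x₀)` with
`t₀ ∈ ]0,T]` the scaled cubic quantity has finite upper limit, `limsup_{r→0⁺} C(z₀,r) < ∞` —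
the robust form of Thm 1.2 asked for in `SereginZhou2020Proofs.lean`.
[cite: SereginZhou2020, Thm 1.2 and Def. 1.3 (remark)] -/
theorem Hypotheses.limsup_cknC_lt_top (hyp : Hypotheses T v q G) {t₀ : ℝ} (ht₀ : t₀ ∈ Ioc 0 T)
    (x₀ : EuclideanSpace ℝ (Fin 3)) :
    limsup (fun r => cknC r (t₀, x₀) v) (𝓝[>] (0 : ℝ)) < ∞ :=
  limsup_cknC_lt_top_of_biSup_lt_top (half_pos (lt_min one_pos ht₀.1))
    (scaledEnergiesEss_lt_top T v q G hyp t₀ ht₀ x₀).2.2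

/-- **All four scaled quantities are bounded near every point** (Thm 1.2 combined with
Seregin's remark "`g < ∞ ⟹ G < ∞`", case `C`, `Seregin2020.scaledEnergies_bounded_of_limsup_cknC_lt_top`):
under `Hypotheses T v q G`, for every `z₀ = (t₀, x₀)` with `t₀ ∈ ]0,T]` there are `K < ∞` and
`r₁ > 0` with `A_ess(r) + E(r) + C(r) + D(r) ≤ K` at `z₀` for all `0 < r ≤ r₁`.
[cite: SereginZhou2020, Thm 1.2] [cite: Seregin2020, remark after Def. 1.7] -/
theorem Hypotheses.exists_scaledEnergies_le (hyp : Hypotheses T v q G) {t₀ : ℝ}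
    (ht₀ : t₀ ∈ Ioc 0 T) (x₀ : EuclideanSpace ℝ (Fin 3)) :
    ∃ K : ℝ≥0, ∃ r₁ : ℝ, 0 < r₁ ∧ ∀ r ∈ Ioc (0 : ℝ) r₁,
      cknAEss r (t₀, x₀) v + cknE r (t₀, x₀) G + cknC r (t₀, x₀) v + cknD r (t₀, x₀) q ≤ K := by
  set R₀ : ℝ := min 1 t₀ / 2 with hR₀
  have hR₀0 : 0 < R₀ := half_pos (lt_min one_pos ht₀.1)
  have hR₀1 : R₀ ≤ 1 / 2 := by rw [hR₀]; linarith [min_le_left (1 : ℝ) t₀]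
  have hR₀t : R₀ ≤ t₀ / 2 := by rw [hR₀]; linarith [min_le_right (1 : ℝ) t₀]
  have hR₀sq : R₀ ^ 2 ≤ t₀ / 4 := by nlinarith
  have ht₀0 : 0 < t₀ := ht₀.1
  have hQ : parabolicCylinder R₀ ((t₀, x₀) : ℝ × EuclideanSpace ℝ (Fin 3)) ⊆
      ((slab (EuclideanSpace ℝ (Fin 3)) (Ioo 0 T) isOpen_Ioo :
        Opens (ℝ × EuclideanSpace ℝ (Fin 3))) : Set (ℝ × EuclideanSpace ℝ (Fin 3))) := by
    intro p hp
    rw [mem_parabolicCylinder] at hp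
    dsimp only at hp
    exact mem_slab.2 ⟨by linarith [hp.1.1], lt_of_lt_of_le hp.1.2 ht₀.2⟩
  have hD₀ : cknD R₀ ((t₀, x₀) : ℝ × EuclideanSpace ℝ (Fin 3)) q ≠ ∞ :=
    hyp.cknD_ne_top hR₀0 (by dsimp only; linarith) ht₀.2
  exact Seregin2020.scaledEnergies_bounded_of_limsup_cknC_lt_top hyp.suitable hyp.weakGradient
    hR₀0 hQ hD₀ (hyp.limsup_cknC_lt_top ht₀ x₀)

end Corollaries

end SereginZhou2020

end Literature.Analysis.FluidPDE
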